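import Summits.QuantumFields.YangMills.Theorems.LangevinControlUVFemtoCurvatureTwoPointCUniformDoublingAll
import Summits.QuantumFields.YangMills.Theorems.BalabanLadderIROddTorusLargeFieldRaritySharp
import Summits.QuantumFields.YangMills.Theorems.BalabanLadderIRTypBallSparseScales
import Summits.QuantumFields.YangMills.Theorems.BalabanLadderNTCouplingSumRuleBudget
import Summits.QuantumFields.YangMills.Theorems.BalabanLadderNTOnePointFloor
import Mathlib.Analysis.SpecialFunctions.Pow.Integral
import Mathlib.Analysis.SpecialFunctions.Gamma.Basic
import HarnessLib

/-!
# Crux `NT` (stmt-QuantumFields-19353): SHARP weak-coupling moments of the plaquette cost and of the action density —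
# `⟨φ_q⟩ ≤ K/β`, `⟨φ_q²⟩ ≤ K/β²`, `6N − E_{T,β}[A_x] ≤ 6K/β` on EVERY odd torus, NO logarithm — hypothesis-free

Fleet lead prover of crux `NT` (unit `ym-spine-19353-p1`, g28), `--supports` helper.  The tree's volume-uniform weak-coupling
one-point and second-moment ceilings in the crux's letters (`AfOnset.exists_plaquetteCost_moments_le`, g8's
`CouplingSumRule.exists_six_mul_sub_torusE_dens_le`, whence `AfOnset.exists_abs_torusCov_dens_le`, `AfOnset.exists_abs_Q2_le_log_sq`,
`UnitNormalForm`, `CouplingSumRuleFloor/SkewSign`) all carry the artefact `(1 + log β)`: `⟨φ_q⟩ ≤ K(1 + log β)/β`,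
`⟨φ_q²⟩ ≤ K(1 + log β)²/β²`.  The artefact is the free-energy input of the chessboard tail: the odd-torus chessboard
(`OddTorusChessboard.measureReal_forall_le_cellAction_le_pow_sharp`, Fröhlich–Israel–Lieb–Simon) bounds `μ_{M,β}{T ≤ φ_q}` by
`exp(−λT/m + Δ_M(λ)/(m M⁴))`, `Δ_M(λ) = log Z_M(β−λ) − log Z_M(β)`, `m = 6` orientations, and the tree fed it the CRUDE increment
`Δ_M(λ) ≤ M⁴(K₀ + D₁ log β)` (`…_rep_sharp`).  Route `LangevinControlUV` (crux `FemtoCurvatureTwoPointC`) landed the SHARP increment on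
ALL tori — the volume-uniform doubling `TorusGauge.uniformDoubling_all`: `Z_M(b/2) ≤ e^{A M⁴} Z_M(b)` for every `M ≥ 2`, `b ≥ 4`
(holonomy-conditioned torus free-energy sandwich).  At `λ = β/2` the tail becomes `e^{A/m} · e^{−βT/(2m)}` — a clean exponential —
and the layer-cake formula gives every moment with its exact power of `β`:

* §1 `integral_rpow_le_of_exp_tail` — layer cake: on a probability space, `0 ≤ φ ≤ B` measurable with
  `μ{t ≤ φ} ≤ C₀ e^{−κt}` (`t > 0`) has `∫ φ^p ≤ p·C₀·Γ(p)/κ^p` for every `p > 0` (Mathlib `lintegral_rpow_eq_lintegral_meas_le_mul`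
  and `Real.integral_rpow_mul_exp_neg_mul_Ioi`).
* §2 (torus `(ℤ/M)⁴`, every compact `G` with a lattice representation `r`)  `exists_torusLogPartition_half_sub_le` (`log Z_M(b/2) −
  log Z_M(b) ≤ A M⁴`, `M ≥ 2`, `b ≥ 4`), **`exists_plaquetteCost_tail`** (`μ_{M,b}{t ≤ φ_q} ≤ C₀ e^{−bt/12}` for every ODD `M ≥ 3`,
  `b ≥ 4`, plaquette `q`, `t > 0`), **`exists_plaquetteCost_rpow_le`** (`⟨φ_q^p⟩_{M,b} ≤ K_p/b^p`, every `p > 0`).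
* §3 (NT letters: odd tori `2L+1`, `L ≥ 1`, `β ≥ 4`)  **`exists_plaquetteCost_moments_le_sharp`** — the statement of
  `AfOnset.exists_plaquetteCost_moments_le` WITHOUT the logarithms: `⟨φ_q⟩ ≤ K/β ∧ ⟨φ_q²⟩ ≤ K/β²` for every plaquette `q`;
  **`exists_six_mul_sub_torusE_dens_le_sharp`** — `6N − E_{T,β}[A_x] ≤ 6K/β` for all `L ≥ 1`, `β ≥ 4`, `x` (g8's ceiling without the
  log); with g9's equipartition floor (`LinkEquipartition.exists_six_mul_sub_torusE_dens_ge_of_simple`) the **two-sided pin**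
  `onePoint_pin_of_simple`: `c/β ≤ 6N − E_{T,β}[A_x] ≤ C/β` for every compact SIMPLE `G`, all odd tori `2L+1 ≥ 5`, all large `β` — the
  mean action density of lattice Yang–Mills is EXACTLY of order `1/β`, uniformly in the volume.

The two-point consequences (`|Cov_T(A_x,A_y)| ≤ W/β²`, `|Q2| ≤ K/(β² min(s,1)⁸)`, the unit envelope `a(β) ≤ K β^{−1/4}`) and the
log-free octave sum rules are drawn in the sequels `Theorems/BalabanLadderNTSharpTwoPointCeiling` / `…NTCouplingSumRuleOctaves`.

HONEST FRAMING.  Elementary given the cited tree theorems (the mathematics is the torus sandwich of `FemtoCurvatureTwoPointC` and the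
odd-torus chessboard); kinematic weak-coupling bookkeeping valid for every compact gauge group; perturbatively visible (tree level);
says nothing about NT's β-uniform floor in a unit `a(β) → 0`, the seam or the gap.  NT is NOT proved; the Yang–Mills mass gap is NOT
proved; not Clay.  Refs: Fröhlich–Israel–Lieb–Simon, CMP 62 (1978) §4; Montvay–Münster 1994 §3.2 (3.113); S. Chatterjee, JFA 271 (2016)
Thm. 2.1 [arXiv160201222].
-/

set_option autoImplicit false

noncomputable section

open MeasureTheory Filter Topology Finset Set
open scoped BigOperators ENNReal
open Literature.MathematicalPhysics.QuantumFieldTheory hiding ZdEdge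
open Literature.MathematicalPhysics.QuantumLattice (torusLogPartition torusLift)
open Summit.QuantumFields.YangMills.Cruxes.OSLegsFromFemtoAndGap.DlrCollarTransfer (torusE dens)
open Summit.QuantumFields.YangMills.Theorems.FemtoCurvatureTwoPoint.PlaquetteVariance (partitionFunction_toReal_pos)
open Summit.QuantumFields.YangMills.Theorems.OddTorusChessboard (Orient measureReal_forall_le_cellAction_le_pow_sharp
  card_orient_four)
open Summit.QuantumFields.YangMills.Theorems.CurvatureBoostCovariance.Negative (card_planes)
open Literature.MathematicalPhysics.QuantumFieldTheory.WilsonRP (plaqRe abs_plaqRe_le measurable_plaqRe)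

namespace Summit.QuantumFields.YangMills.Cruxes.NT.SharpCeilings

/-! ## §1 Layer cake: moments from an exponential tail -/

section LayerCake

variable {Ω : Type*} [MeasurableSpace Ω]

/-- **Moments from an exponential tail (layer cake).**  On a probability space, a measurable `φ ≥ 0` with
`μ{t ≤ φ} ≤ C₀ e^{−κ t}` for all `t > 0` (`C₀ ≥ 0`, `κ > 0`) satisfies `∫ φ^p dμ ≤ p · C₀ · Γ(p) / κ^p` for every `p > 0`
(`∫ φ^p = p ∫₀^∞ t^{p−1} μ{t ≤ φ} dt`, Mathlib's `lintegral_rpow_eq_lintegral_meas_le_mul`, and the Gamma integral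
`∫₀^∞ t^{p−1} e^{−κt} dt = Γ(p)/κ^p`, Mathlib's `Real.integral_rpow_mul_exp_neg_mul_Ioi`). [folklore] -/
theorem integral_rpow_le_of_exp_tail (μ : Measure Ω) [IsProbabilityMeasure μ] {φ : Ω → ℝ} (hφm : Measurable φ)
    (hφ0 : ∀ ω, 0 ≤ φ ω) {C₀ κ : ℝ} (hC₀ : 0 ≤ C₀) (hκ : 0 < κ)
    (htail : ∀ t : ℝ, 0 < t → μ.real {ω | t ≤ φ ω} ≤ C₀ * Real.exp (-(κ * t))) {p : ℝ} (hp : 0 < p) :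
    ∫ ω, φ ω ^ p ∂μ ≤ p * C₀ * Real.Gamma p / κ ^ p := by
  have hmeas_p : AEStronglyMeasurable (fun ω => φ ω ^ p) μ := (hφm.pow_const p).aestronglyMeasurable
  rw [integral_eq_lintegral_of_nonneg_ae (ae_of_all _ fun ω => Real.rpow_nonneg (hφ0 ω) p) hmeas_p]
  have hlc := lintegral_rpow_eq_lintegral_meas_le_mul μ (ae_of_all _ hφ0) hφm.aemeasurable hp
  set X : ℝ := C₀ * ((1 / κ) ^ p * Real.Gamma p) with hX
  have hΓ : 0 < Real.Gamma p := Real.Gamma_pos_of_pos hp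
  have hX0 : 0 ≤ X := by positivity
  -- the Gamma integrand is integrable on `(0, ∞)`
  have hint : IntegrableOn (fun t : ℝ => t ^ (p - 1) * Real.exp (-(κ * t))) (Ioi 0) := by
    refine Integrable.of_integral_ne_zero ?_
    rw [Real.integral_rpow_mul_exp_neg_mul_Ioi hp hκ]
    exact mul_ne_zero (by positivity) hΓ.ne'
  -- the inner layer-cake integral
  have hinner : ∫⁻ t in Ioi (0 : ℝ), μ {a | t ≤ φ a} * ENNReal.ofReal (t ^ (p - 1)) ≤ ENNReal.ofReal X := by
    calc ∫⁻ t in Ioi (0 : ℝ), μ {a | t ≤ φ a} * ENNReal.ofReal (t ^ (p - 1))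
        ≤ ∫⁻ t in Ioi (0 : ℝ), ENNReal.ofReal (C₀ * (t ^ (p - 1) * Real.exp (-(κ * t)))) := by
          refine setLIntegral_mono' measurableSet_Ioi fun t ht => ?_
          have ht0 : 0 < t := ht
          rw [← ofReal_measureReal, ← ENNReal.ofReal_mul measureReal_nonneg]
          refine ENNReal.ofReal_le_ofReal ?_
          have htp : 0 ≤ t ^ (p - 1) := Real.rpow_nonneg ht0.le _
          calc μ.real {a | t ≤ φ a} * t ^ (p - 1) ≤ C₀ * Real.exp (-(κ * t)) * t ^ (p - 1) :=
                mul_le_mul_of_nonneg_right (htail t ht0) htp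
            _ = C₀ * (t ^ (p - 1) * Real.exp (-(κ * t))) := by ring
      _ = ENNReal.ofReal (∫ t in Ioi (0 : ℝ), C₀ * (t ^ (p - 1) * Real.exp (-(κ * t)))) := by
          rw [ofReal_integral_eq_lintegral_ofReal (hint.const_mul C₀)]
          refine (ae_restrict_iff' measurableSet_Ioi).2 (ae_of_all _ fun t ht => ?_)
          have ht0 : 0 < t := ht
          have : 0 ≤ t ^ (p - 1) := Real.rpow_nonneg ht0.le _
          positivity
      _ = ENNReal.ofReal X := by
          rw [integral_const_mul, Real.integral_rpow_mul_exp_neg_mul_Ioi hp hκ]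
  have hle : ∫⁻ ω, ENNReal.ofReal (φ ω ^ p) ∂μ ≤ ENNReal.ofReal (p * X) := by
    rw [hlc, ENNReal.ofReal_mul hp.le]
    exact mul_le_mul' le_rfl hinner
  have h := ENNReal.toReal_le_of_le_ofReal (by positivity) hle
  calc (∫⁻ ω, ENNReal.ofReal (φ ω ^ p) ∂μ).toReal ≤ p * X := h
    _ = p * C₀ * Real.Gamma p / κ ^ p := by
        rw [hX, Real.div_rpow zero_le_one hκ.le, Real.one_rpow]
        field_simp

end LayerCake

/-! ## §2 Torus level: the sharp increment, the exponential plaquette tail, sharp moments of every order -/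

section Torus

variable {G : Type} [Group G] [TopologicalSpace G] [IsTopologicalGroup G] [CompactSpace G]
  [MeasurableSpace G] [BorelSpace G]

/-- **The sharp free-energy increment over one halving, ALL tori**: there is `A ≥ 0` (the doubling constant of
`TorusGauge.uniformDoubling_all`) with `log Z_M(b/2) − log Z_M(b) ≤ A·M⁴` for every torus `M ≥ 2` and every `b ≥ 4`. [folklore] -/
theorem exists_torusLogPartition_half_sub_le [SecondCountableTopology G] (r : LatticeRep G) :
    ∃ A : ℝ, 0 ≤ A ∧ ∀ (M : ℕ) [NeZero M] (b : ℝ), 2 ≤ M → 4 ≤ b →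
      torusLogPartition 4 r.ρ (b / 2) M - torusLogPartition 4 r.ρ b M ≤ A * (M : ℝ) ^ 4 := by
  obtain ⟨A₀, hA₀⟩ := Summit.QuantumFields.YangMills.Theorems.FemtoCurvatureTwoPointC.TorusGauge.uniformDoubling_all r
  refine ⟨max A₀ 0, le_max_right _ _, ?_⟩
  intro M _ b hM hb
  have hZpos : ∀ t : ℝ, 0 < (partitionFunction (d := 4) (L := M) r.ρ t).toReal :=
    fun t => partitionFunction_toReal_pos (d := 4) (L := M) r.ρ r.continuous t
  have hdbl := hA₀ M b hM hb
  have h1 : Real.log (partitionFunction (d := 4) (L := M) r.ρ (b / 2)).toReal ≤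
      A₀ * (M : ℝ) ^ 4 + Real.log (partitionFunction (d := 4) (L := M) r.ρ b).toReal := by
    have := Real.log_le_log (hZpos _) hdbl
    rwa [Real.log_mul (Real.exp_pos _).ne' (hZpos _).ne', Real.log_exp] at this
  have h2 : A₀ * (M : ℝ) ^ 4 ≤ max A₀ 0 * (M : ℝ) ^ 4 := mul_le_mul_of_nonneg_right (le_max_left _ _) (by positivity)
  unfold torusLogPartition
  linarith

/-- **The exponential plaquette tail at weak coupling, uniformly in the odd torus**: there is `C₀ ≥ 1` with
`μ_{M,b}{t ≤ φ_q} ≤ C₀ · e^{−b t/12}` for every ODD torus `M ≥ 3`, every `b ≥ 4`, every plaquette `q` and every `t > 0`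
(the odd-torus chessboard `OddTorusChessboard.measureReal_forall_le_cellAction_le_pow_sharp` on the one-plaquette cell at `λ = b/2`,
`m = 6` orientations, fed with the SHARP increment `log Z_M(b/2) − log Z_M(b) ≤ A M⁴`: `C₀ = e^{A/6}`). [folklore] -/
theorem exists_plaquetteCost_tail [SecondCountableTopology G] (r : LatticeRep G) :
    ∃ C₀ : ℝ, 1 ≤ C₀ ∧ ∀ (M : ℕ) [NeZero M] (b : ℝ), Odd M → 3 ≤ M → 4 ≤ b →
      ∀ (q : Plaquette 4 M) (t : ℝ), 0 < t →
        (wilsonMeasure (d := 4) (L := M) r.ρ b).real {U | t ≤ plaquetteCost r.ρ U q} ≤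
          C₀ * Real.exp (-(b / 12 * t)) := by
  obtain ⟨A, hA0, hA⟩ := exists_torusLogPartition_half_sub_le r
  refine ⟨Real.exp (A / 6), by simpa using Real.exp_le_exp.2 (by positivity : (0 : ℝ) ≤ A / 6), ?_⟩
  intro M _ b hodd hM hb q t _
  have hM2 : 2 ≤ M := le_trans (by norm_num) hM
  have hb0 : 0 < b := by linarith
  have hm : 0 < Fintype.card (Orient 4) := by rw [card_orient_four]; norm_num
  have hlam : (0 : ℝ) ≤ b / 2 := by positivity
  have hlamβ : b / 2 ≤ b := by linarith
  have htail0 := measureReal_forall_le_cellAction_le_pow_sharp (d := 4) (L := M) r.ρ hodd hM r.continuous hlam hlamβ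
    (Finset.univ : Finset Unit) (fun _ => ({q} : Finset (Plaquette 4 M)))
    (fun i _ j _ hij => absurd (Subsingleton.elim i j) hij) (n := 1) (fun i _ => by simp) t hm
  have hset : {U : GaugeConfig 4 M G | ∀ i ∈ (Finset.univ : Finset Unit),
      t ≤ ∑ q' ∈ ({q} : Finset (Plaquette 4 M)), plaquetteCost r.ρ U q'} = {U | t ≤ plaquetteCost r.ρ U q} := by
    ext U; simp
  rw [hset, Finset.card_univ, Fintype.card_unit, pow_one, Nat.cast_one, one_mul, card_orient_four] at htail0
  refine htail0.trans (Real.exp_le_exp.2 ?_ |>.trans (le_of_eq (Real.exp_add _ _)))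
  -- exponent bookkeeping: `−(b/2)t/6 + Δ/(M⁴·6) ≤ A/6 + (−(b/12) t)`
  have hM0 : (0 : ℝ) < (M : ℝ) ^ 4 := by positivity
  have hΔ : (torusLogPartition 4 r.ρ (b - b / 2) M - torusLogPartition 4 r.ρ b M) / (M : ℝ) ^ 4 ≤ A := by
    rw [show b - b / 2 = b / 2 by ring, div_le_iff₀ hM0]
    exact hA M b hM2 hb
  push_cast
  have e1 : -(b / 2 * t) / (6 : ℝ) = -(b / 12 * t) := by ring
  rw [e1]
  have : (torusLogPartition 4 r.ρ (b - b / 2) M - torusLogPartition 4 r.ρ b M) / (M : ℝ) ^ 4 / 6 ≤ A / 6 :=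
    div_le_div_of_nonneg_right hΔ (by norm_num)
  linarith

/-- **Sharp moments of every order of the plaquette cost, uniformly in the odd torus**: for every `p > 0` there is `K ≥ 0` with
`⟨φ_q^p⟩_{M,b} ≤ K/b^p` for every ODD torus `M ≥ 3`, `b ≥ 4` and plaquette `q` (layer cake on the exponential tail:
`K = p · C₀ · Γ(p) · 12^p`). [folklore] -/
theorem exists_plaquetteCost_rpow_le [SecondCountableTopology G] (r : LatticeRep G) {p : ℝ} (hp : 0 < p) :
    ∃ K : ℝ, 0 ≤ K ∧ ∀ (M : ℕ) [NeZero M] (b : ℝ), Odd M → 3 ≤ M → 4 ≤ b → ∀ q : Plaquette 4 M,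
      ∫ U, plaquetteCost r.ρ U q ^ p ∂(wilsonMeasure (d := 4) (L := M) r.ρ b) ≤ K / b ^ p := by
  obtain ⟨C₀, hC₀1, hC₀⟩ := exists_plaquetteCost_tail r
  have hC₀0 : 0 ≤ C₀ := le_trans zero_le_one hC₀1
  have hΓ : 0 < Real.Gamma p := Real.Gamma_pos_of_pos hp
  refine ⟨p * C₀ * Real.Gamma p * 12 ^ p, by positivity, ?_⟩
  intro M _ b hodd hM hb q
  have hb0 : 0 < b := by linarith
  haveI := isProbabilityMeasure_wilsonMeasure (d := 4) (L := M) (G := G) r.ρ r.continuous b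
  have hmeas : Measurable fun U : GaugeConfig 4 M G => plaquetteCost r.ρ U q :=
    measurable_const.sub (measurable_plaqRe r.ρ r.continuous q)
  have h0 : ∀ U : GaugeConfig 4 M G, 0 ≤ plaquetteCost r.ρ U q := fun U => by
    have h := abs_le.1 (abs_plaqRe_le r.ρ r.continuous U q)
    change 0 ≤ (r.N : ℝ) - plaqRe r.ρ U q
    linarith [h.2]
  have hκ : 0 < b / 12 := by positivity
  have h := integral_rpow_le_of_exp_tail (wilsonMeasure (d := 4) (L := M) r.ρ b) hmeas h0 hC₀0 hκ
    (fun t ht => hC₀ M b hodd hM hb q t ht) hp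
  calc ∫ U, plaquetteCost r.ρ U q ^ p ∂(wilsonMeasure (d := 4) (L := M) r.ρ b)
      ≤ p * C₀ * Real.Gamma p / (b / 12) ^ p := h
    _ = p * C₀ * Real.Gamma p * 12 ^ p / b ^ p := by
        rw [Real.div_rpow hb0.le (by norm_num)]
        field_simp

end Torus

/-! ## §3 NT letters: the sharp plaquette moments and the sharp one-point ceiling on every odd torus `2L+1` -/

section NT

variable (G : Type) [Group G] [TopologicalSpace G] [IsTopologicalGroup G] [CompactSpace G]
  [MeasurableSpace G] [BorelSpace G] (r : LatticeRep G)

/-- **`AfOnset.exists_plaquetteCost_moments_le` WITHOUT the logarithms.**  For a lattice representation `r` there is `K ≥ 0`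
such that on every odd four-torus `2L+1`, `L ≥ 1`, at every `β ≥ 4`, for every plaquette `q`:
`⟨φ_q⟩_β ≤ K/β` and `⟨φ_q²⟩_β ≤ K/β²`, `φ_q = N − Re tr r(U_q)`. [folklore] -/
theorem exists_plaquetteCost_moments_le_sharp :
    ∃ K : ℝ, 0 ≤ K ∧ ∀ (L : ℕ), 1 ≤ L → ∀ β : ℝ, 4 ≤ β → ∀ q : Plaquette 4 (2 * L + 1),
      (∫ U, plaquetteCost r.ρ U q ∂(wilsonMeasure (d := 4) (L := 2 * L + 1) r.ρ β) ≤ K / β) ∧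
      (∫ U, plaquetteCost r.ρ U q ^ 2 ∂(wilsonMeasure (d := 4) (L := 2 * L + 1) r.ρ β) ≤ K / β ^ 2) := by
  haveI : SecondCountableTopology G :=
    (r.continuous.isClosedEmbedding r.injective).isEmbedding.secondCountableTopology
  obtain ⟨K₁, hK₁0, hK₁⟩ := exists_plaquetteCost_rpow_le r one_pos
  obtain ⟨K₂, hK₂0, hK₂⟩ := exists_plaquetteCost_rpow_le r two_pos
  refine ⟨max K₁ K₂, le_max_of_le_left hK₁0, fun L hL β hβ q => ?_⟩
  have hM3 : 3 ≤ 2 * L + 1 := by omega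
  have hodd : Odd (2 * L + 1) := odd_two_mul_add_one L
  have hβ0 : 0 < β := by linarith
  have h1 := hK₁ (2 * L + 1) β hodd hM3 hβ q
  have h2 := hK₂ (2 * L + 1) β hodd hM3 hβ q
  simp only [Real.rpow_one] at h1
  constructor
  · exact h1.trans (div_le_div_of_nonneg_right (le_max_left _ _) hβ0.le)
  · have h2' : ∫ U, plaquetteCost r.ρ U q ^ 2 ∂(wilsonMeasure (d := 4) (L := 2 * L + 1) r.ρ β) ≤ K₂ / β ^ 2 := by
      have e : ∀ U : GaugeConfig 4 (2 * L + 1) G, plaquetteCost r.ρ U q ^ (2 : ℝ) = plaquetteCost r.ρ U q ^ (2 : ℕ) :=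
        fun U => Real.rpow_two _
      simp only [e, Real.rpow_two] at h2
      exact h2
    exact h2'.trans (div_le_div_of_nonneg_right (le_max_right _ _) (by positivity))

/-- **The one-point ceiling WITHOUT the logarithm** (g8's `CouplingSumRule.exists_six_mul_sub_torusE_dens_le`, sharpened):
there is `K ≥ 0` with `6N − E_{T,β}[A_x] ≤ 6K/β` for all `L ≥ 1`, `β ≥ 4`, `x` (`E_{T,β}[A_x] = Σ_q (N − ⟨φ_{(x̄,q)}⟩)` over the
six orientations, `CouplingSumRule.torusE_dens_eq_sum_orient`). [folklore] -/
-- adapted from `CouplingSumRule.exists_six_mul_sub_torusE_dens_le` (`Theorems/BalabanLadderNTCouplingSumRuleBudget`)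
theorem exists_six_mul_sub_torusE_dens_le_sharp :
    ∃ K : ℝ, 0 ≤ K ∧ ∀ (L : ℕ), 1 ≤ L → ∀ β : ℝ, 4 ≤ β → ∀ x : Fin 4 → ℤ,
      6 * (r.N : ℝ) - torusE G r β L (dens G r x) ≤ 6 * K / β := by
  obtain ⟨K, hK0, hK⟩ := exists_plaquetteCost_moments_le_sharp G r
  refine ⟨K, hK0, fun L hL β hβ x => ?_⟩
  rw [Summit.QuantumFields.YangMills.Cruxes.NT.CouplingSumRule.torusE_dens_eq_sum_orient]
  have h1 : ∀ q : Plaquette 4 (2 * L + 1),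
      ∫ U, plaquetteCost r.ρ U q ∂(wilsonMeasure (d := 4) (L := 2 * L + 1) r.ρ β) ≤ K / β :=
    fun q => (hK L hL β hβ q).1
  have hsum : ∑ q : {q : Fin 4 × Fin 4 // q.1 < q.2},
      ∫ U, plaquetteCost r.ρ U (Literature.Probability.LatticeModels.Torus.proj (2 * L + 1) x, q)
        ∂(wilsonMeasure (d := 4) (L := 2 * L + 1) r.ρ β) ≤ 6 * (K / β) := by
    calc _ ≤ ∑ _q : {q : Fin 4 × Fin 4 // q.1 < q.2}, K / β := Finset.sum_le_sum fun q _ => h1 _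
      _ = 6 * (K / β) := by
        rw [Finset.sum_const, Finset.card_univ, card_planes, nsmul_eq_mul]; push_cast; ring
  rw [Finset.sum_sub_distrib, Finset.sum_const, Finset.card_univ, card_planes, nsmul_eq_mul]
  push_cast
  have : 6 * K / β = 6 * (K / β) := by ring
  rw [this]
  linarith

/-- **The two-sided one-point PIN for compact simple gauge groups, uniformly in the volume**: for every compact SIMPLE `G` and
lattice representation `r` there are `0 < c ≤ C` and `β₀ > 0` with `c/β ≤ 6N − E_{T,β}[A_x] ≤ C/β` for all `β ≥ β₀`, all odd tori
`2L+1 ≥ 5` (`L ≥ 2`) and all sites — the mean action density of lattice Yang–Mills is EXACTLY of order `1/β`, uniformly in `L`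
(g9's equipartition floor `LinkEquipartition.exists_six_mul_sub_torusE_dens_ge_of_simple` and the sharp ceiling). [folklore] -/
theorem onePoint_pin_of_simple (hG : IsCompactSimpleLieGroup G) :
    ∃ c C β₀ : ℝ, 0 < c ∧ c ≤ C ∧ 0 < β₀ ∧ ∀ β : ℝ, β₀ ≤ β → ∀ (L : ℕ), 2 ≤ L → ∀ x : Fin 4 → ℤ,
      c / β ≤ 6 * (r.N : ℝ) - torusE G r β L (dens G r x) ∧
        6 * (r.N : ℝ) - torusE G r β L (dens G r x) ≤ C / β := by
  obtain ⟨c, β₁, hc, hβ₁, hfloor⟩ :=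
    Summit.QuantumFields.YangMills.Cruxes.NT.LinkEquipartition.exists_six_mul_sub_torusE_dens_ge_of_simple G r hG
  obtain ⟨K, hK0, hceil⟩ := exists_six_mul_sub_torusE_dens_le_sharp G r
  refine ⟨c, max c (6 * K), max β₁ 4, hc, le_max_left _ _, lt_of_lt_of_le hβ₁ (le_max_left _ _), ?_⟩
  intro β hβ L hL x
  have hβ1 : β₁ ≤ β := le_trans (le_max_left _ _) hβ
  have hβ4 : 4 ≤ β := le_trans (le_max_right _ _) hβ
  have hβ0 : 0 < β := by linarith
  refine ⟨hfloor β hβ1 L hL x, (hceil L (le_trans one_le_two hL) β hβ4 x).trans ?_⟩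
  exact div_le_div_of_nonneg_right (le_max_right _ _) hβ0.le

end NT

end Summit.QuantumFields.YangMills.Cruxes.NT.SharpCeilings

end
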